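import Summits.QuantumFields.BalabanUV.Beta.SecondOrderContactForm

/-!
# `BalabanUV.Beta.SecondOrderContactResidual` — binder row D1, W-side (L4), piece (W-X) part 2: the mixed commutator family, the exact
# `conjW₁`/`dM` assembly, and THE DISPLAYED RESIDUAL of the ♯-response through an2's second-order carrier
# (β sub-cell, row BETA-an2 = BINDER-OWNERS row D1 OWNER, lineage an2 gen 17; sequel of `SecondOrderContactForm`)

HONEST FRAMING (cell charter, verbatim): «discharging BetaPertH makes Balaban's UV stability UNCONDITIONAL — a real
constructive-QFT result; it is NOT the continuum limit and NOT the Clay problem.»  HONEST DEPENDENCY (verbatim): «continuum YM on T⁴ ⇐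
BetaPertH ∧ nine spine estimates (0/9 proved); BetaPertH ⇐ (D1) ∧ (D4) ∧ CAP+tail; G-an2-4 gates asym, D1 and NE2/3/4.»  DERIVED cell leaf:
[folklore] kernel algebra (entrywise diagonal calculus, additivity of absolutely convergent weighted sums, an5's tame re-association);
no statement of Bałaban's papers is typed here, no `[cite:]` tag, no `def`, no `Prop` fact; instantiates NO binder of the wall.  NOT D1,
NOT `BetaPertH`, NOT continuum, NOT Clay.

## What (♯-tables of similarity shape with DIAGONAL generators `X κ u = diagK (g κ u)`, dressed symbol `G^A b p c = Σ_κ Σ'_u colH A N b κ u · g κ u p c`)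

* §3 `vertexOfM_conjV_diagK_fixed`, **`mixOfK_conjV_diag`**: `mixOfK K N (κ u ρ w ↦ conjV (M ρ w) (X κ u)) b c = conjV (vertexOfM K N M c) (diagK (G b))`
  — the ♯-piece of the MIXED table is the commutator of the coarse multiplier vertex with the dressed generator; `conjW₁_add_diag`,
  **`conjW₁_dM`**: with part 1's `vertex2OfK_conjW_diag` the two mixed pieces complete the `conjW₁` part EXACTLY at `V = dM K N S M`
  (field + multiplier first-order letters — the Lagrangian-chart vertex); `dM_kernel_add`, `dM_table_add`, `dM_table_sharp_split`
  (`dM A N S♯ M b = dM A N S M b + conjV 𝕄 (diagK (G^A b))` for ANY reading kernel `A`).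
* §4 `K2OfK_table_add`, **`K2OfK_sharp_split`**: `K2OfK K N S♯ M c = K2OfK K N S M c + Ξ c`, **`Ξ c := −(K ∘ conjV 𝕄 (diagK (G c)) ∘ K)`**
  (under `RelInv K 𝕄 E` with `E`-commuting generators this is `K∘𝒳_c − 𝒳_c∘K`, `RelInvSandwich` — not used here); **`resp_sharp_split`**:
  `dM (K2OfK K N S M c + Ξ c) N S♯ M b = dM (K2OfK K N S M c) N S M b + Δ b c + conjV 𝕄 (diagK (G^{K2+Ξ} b))` with THE RESIDUAL
  **`Δ b c := dM (Ξ c) N S M b`** — the columns of `Ξ c` read against the UNCONTACTED first-order tables.  Summing up (prose, each piece a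
  theorem of parts 1–2 + `SecondOrderTransport`): `W2OfK K N S♯ M S₂♯ M₂♯ b c − W2OfK K N S M S₂ M₂ b c = conjW 𝕄 (dM b) (dM c) 𝒳_b 𝒳_c X₂⋆ + Δ b c`
  with `X₂⋆ b c = diagK (H b c + G^{K2OfK … c + Ξ c} b)`; so the hR socket `hWrC` for the (L4-D) literal holds in an5's form IFF `Δ` is itself
  a `[𝕄, ·]`-contact, and the assembled one-loop form needs only `tadpole G_j (Δ b c) = 0` (an5's `conj_defect_rel`).  WHICH of these holds
  for the wall's objects is (W-E) — NOT decided here.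

Provenance: β sub-cell, unit beta-an2 gen 17, 2026-08-20 (v1); BY NAME over part 1, `SecondOrderTransport`, an5's `ChartConjugation` /
`TameKernelCalculus`, an2's `DiagonalContact`, an3's `VertexReflectionContact`; no existing file touched.
-/

noncomputable section

open Finset
open scoped BigOperators
open Literature.MathematicalPhysics.QuantumFieldTheory
open Literature.MathematicalPhysics.QuantumFieldTheory.Balaban1983to89
open Literature.MathematicalPhysics.QuantumFieldTheory.Balaban1983to89.Beta
open ExpKernelCalculus (MKer comp)
open OneStepResolventKernel (Fib wsum)
open OneStepKernelFamily (colH vertexOfK)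
open InterLevelTransport (cwsum cwsum_apply)
open SecondOrderResponse (colM vertexOfM dM K2OfK vertex2OfK mixOfK)
open Summit.QuantumFields.BalabanUV.Beta.TameKernelCalculus (Spr Loc Tame comp_add_right_tame comp_add_left_tame)
open Summit.QuantumFields.BalabanUV.Beta.ChartConjugation (conjV conjW conjW₁ conjW₂ loc_conjV)
open Summit.QuantumFields.BalabanUV.Beta.BorderedHessian (diagK diagK_apply comp_diagK_right comp_diagK_left conjV_diagK_apply)
open Summit.QuantumFields.BalabanUV.Beta.VertexReflectionContact (vertexOfK_conjV_diagK)
open Summit.QuantumFields.BalabanUV.Beta.SecondOrderContactForm (vertexOfK_add_of_summable)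

namespace Summit.QuantumFields.BalabanUV.Beta.SecondOrderContactForm

variable {d N : ℕ}

/-! ## §3 The mixed commutator family and the first-order pieces of `dM` -/

section Mixed

variable (K : MKer (d + 1) (Fib d)) (N : ℕ) [NeZero N]

/-- [folklore] **THE MULTIPLIER-COLUMN VERTEX OF A FIXED DIAGONAL CONTACT OF THE TABLE**: `vertexOfM K N (ρ w ↦ conjV (M ρ w) (diagK g₀)) c =
conjV (vertexOfM K N M c) (diagK g₀)` (entrywise; no summability). -/
theorem vertexOfM_conjV_diagK_fixed (M : Fin (d + 1) → (Fin (d + 1) → ℤ) → MKer (d + 1) (Fib d)) (g₀ : (Fin (d + 1) → ℤ) → Fib d → ℝ)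
    (ν : Fin (d + 1)) (y' : Fin (d + 1) → ℤ) :
    vertexOfM K N (fun ρ w => conjV (M ρ w) (diagK g₀)) ν y' = conjV (vertexOfM K N M ν y') (diagK g₀) := by
  funext x z a b
  rw [conjV_diagK_apply]
  simp only [vertexOfM, cwsum_apply, conjV_diagK_apply]
  have e : ∀ (ρ : Fin (d + 1)) (w : Fin (d + 1) → ℤ), colM K N ν y' ρ w * (M ρ w x z a b * (g₀ z b - g₀ x a)) =
      colM K N ν y' ρ w * M ρ w x z a b * (g₀ z b - g₀ x a) := fun ρ w => by ring
  simp_rw [e, tsum_mul_right, ← Finset.sum_mul]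

/-- [folklore] **THE MIXED BI-VERTEX OF THE COMMUTATOR FAMILY IS THE COMMUTATOR OF THE COARSE LETTERS**:
`mixOfK K N (κ u ρ w ↦ conjV (M ρ w) (diagK (g κ u))) b c = conjV (vertexOfM K N M c) (diagK (G b))` (`G b` the dressed symbol). -/
theorem mixOfK_conjV_diag (M : Fin (d + 1) → (Fin (d + 1) → ℤ) → MKer (d + 1) (Fib d))
    (g : Fin (d + 1) → (Fin (d + 1) → ℤ) → (Fin (d + 1) → ℤ) → Fib d → ℝ) (μ : Fin (d + 1)) (y : Fin (d + 1) → ℤ) (ν : Fin (d + 1))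
    (y' : Fin (d + 1) → ℤ)
    (hg : ∀ (μ : Fin (d + 1)) (y : Fin (d + 1) → ℤ) (κ : Fin (d + 1)) (p : Fin (d + 1) → ℤ) (c : Fib d),
      Summable fun u => colH K N μ y κ u * g κ u p c) :
    mixOfK K N (fun κ u ρ w => conjV (M ρ w) (diagK (g κ u))) μ y ν y' =
      conjV (vertexOfM K N M ν y') (diagK fun p c => ∑ κ, ∑' u, colH K N μ y κ u * g κ u p c) := by
  show vertexOfK K N (fun κ u => vertexOfM K N (fun ρ w => conjV (M ρ w) (diagK (g κ u))) ν y') μ y = _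
  simp_rw [vertexOfM_conjV_diagK_fixed]
  exact vertexOfK_conjV_diagK K _ N g hg μ y

end Mixed

section FirstOrder

variable (K : MKer (d + 1) (Fib d)) (N : ℕ)

/-- [folklore] Right composition with a diagonal kernel distributes over `+` (entrywise). -/
theorem add_comp_diagK (A B : MKer (d + 1) (Fib d)) (g₀ : (Fin (d + 1) → ℤ) → Fib d → ℝ) :
    comp (A + B) (diagK g₀) = comp A (diagK g₀) + comp B (diagK g₀) := by
  funext x z a b; simp only [Pi.add_apply, comp_diagK_right]; ring

/-- [folklore] Left composition with a diagonal kernel distributes over `+` (entrywise). -/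
theorem diagK_comp_add (A B : MKer (d + 1) (Fib d)) (g₀ : (Fin (d + 1) → ℤ) → Fib d → ℝ) :
    comp (diagK g₀) (A + B) = comp (diagK g₀) A + comp (diagK g₀) B := by
  funext x z a b; simp only [Pi.add_apply, comp_diagK_left]; ring

/-- [folklore] **`conjW₁` IS BI-ADDITIVE IN THE VERTEX LETTERS** (diagonal generators): the extra pieces are `conjV` contacts OF THE TABLES. -/
theorem conjW₁_add_diag (V V₁ Vp Vp₁ : MKer (d + 1) (Fib d)) (g₀ g₀' : (Fin (d + 1) → ℤ) → Fib d → ℝ) :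
    conjW₁ (V + V₁) (Vp + Vp₁) (diagK g₀) (diagK g₀') =
      conjW₁ V Vp (diagK g₀) (diagK g₀') + conjV Vp₁ (diagK g₀) + conjV V₁ (diagK g₀') := by
  unfold ChartConjugation.conjW₁ ChartConjugation.conjV
  rw [add_comp_diagK, add_comp_diagK, diagK_comp_add, diagK_comp_add]
  abel

/-- [folklore] **THE `conjW₁` PART ASSEMBLES EXACTLY WITH `V = dM`**: `conjW₁ (dM K N S M b) (dM K N S M c) 𝒳_b 𝒳_c` = the field–field piece
`conjW₁ (vertexOfK S b) (vertexOfK S c) 𝒳_b 𝒳_c` (from `vertex2OfK_conjW_diag`) + the two mixed pieces `conjV (vertexOfM M c) 𝒳_b`, `conjV (vertexOfM M b) 𝒳_c`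
(from `mixOfK_conjV_diag` in both orders). -/
theorem conjW₁_dM (S M : Fin (d + 1) → (Fin (d + 1) → ℤ) → MKer (d + 1) (Fib d)) (g₀ g₀' : (Fin (d + 1) → ℤ) → Fib d → ℝ) (μ : Fin (d + 1))
    (y : Fin (d + 1) → ℤ) (ν : Fin (d + 1)) (y' : Fin (d + 1) → ℤ) :
    conjW₁ (dM K N S M μ y) (dM K N S M ν y') (diagK g₀) (diagK g₀') =
      conjW₁ (vertexOfK K N S μ y) (vertexOfK K N S ν y') (diagK g₀) (diagK g₀') +
        conjV (vertexOfM K N M ν y') (diagK g₀) + conjV (vertexOfM K N M μ y) (diagK g₀') := by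
  unfold SecondOrderResponse.dM
  exact conjW₁_add_diag _ _ _ _ g₀ g₀'

/-- [folklore] **THE TABLE SLOT OF `dM` IS ADDITIVE IN THE FIELD TABLE** (two entrywise summabilities). -/
theorem dM_table_add (A : MKer (d + 1) (Fib d)) {S C M : Fin (d + 1) → (Fin (d + 1) → ℤ) → MKer (d + 1) (Fib d)} (μ : Fin (d + 1))
    (y : Fin (d + 1) → ℤ)
    (hS : ∀ (κ : Fin (d + 1)) (x z : Fin (d + 1) → ℤ) (a b : Fib d), Summable fun u => colH A N μ y κ u * S κ u x z a b)
    (hC : ∀ (κ : Fin (d + 1)) (x z : Fin (d + 1) → ℤ) (a b : Fib d), Summable fun u => colH A N μ y κ u * C κ u x z a b) :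
    dM A N (fun κ u => S κ u + C κ u) M μ y = dM A N S M μ y + vertexOfK A N C μ y := by
  unfold SecondOrderResponse.dM
  rw [vertexOfK_add_of_summable A μ y hS hC, add_right_comm]

/-- [folklore] `colH` is additive in the kernel. -/
theorem colH_add (A B : MKer (d + 1) (Fib d)) (μ : Fin (d + 1)) (y : Fin (d + 1) → ℤ) (κ : Fin (d + 1)) (u : Fin (d + 1) → ℤ) :
    colH (A + B) N μ y κ u = colH A N μ y κ u + colH B N μ y κ u := rfl

/-- [folklore] `colM` is additive in the kernel. -/
theorem colM_add (A B : MKer (d + 1) (Fib d)) (μ : Fin (d + 1)) (y : Fin (d + 1) → ℤ) (ρ : Fin (d + 1)) (w : Fin (d + 1) → ℤ) :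
    colM (A + B) N μ y ρ w = colM A N μ y ρ w + colM B N μ y ρ w := rfl

/-- [folklore] **THE READING-KERNEL SLOT OF `dM` IS ADDITIVE** (four entrywise summabilities). -/
theorem dM_kernel_add [NeZero N] (A B : MKer (d + 1) (Fib d)) (S M : Fin (d + 1) → (Fin (d + 1) → ℤ) → MKer (d + 1) (Fib d)) (μ : Fin (d + 1))
    (y : Fin (d + 1) → ℤ)
    (hAS : ∀ (κ : Fin (d + 1)) (x z : Fin (d + 1) → ℤ) (a b : Fib d), Summable fun u => colH A N μ y κ u * S κ u x z a b)
    (hBS : ∀ (κ : Fin (d + 1)) (x z : Fin (d + 1) → ℤ) (a b : Fib d), Summable fun u => colH B N μ y κ u * S κ u x z a b)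
    (hAM : ∀ (ρ : Fin (d + 1)) (x z : Fin (d + 1) → ℤ) (a b : Fib d), Summable fun w => colM A N μ y ρ w * M ρ w x z a b)
    (hBM : ∀ (ρ : Fin (d + 1)) (x z : Fin (d + 1) → ℤ) (a b : Fib d), Summable fun w => colM B N μ y ρ w * M ρ w x z a b) :
    dM (A + B) N S M μ y = dM A N S M μ y + dM B N S M μ y := by
  funext x z a b
  simp only [SecondOrderResponse.dM, vertexOfK, vertexOfM, OneStepResolventKernel.wsum, cwsum_apply, Pi.add_apply, colH_add, colM_add,
    add_mul]
  rw [Finset.sum_congr rfl fun κ _ => (hAS κ x z a b).tsum_add (hBS κ x z a b),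
    Finset.sum_congr rfl fun ρ _ => (hAM ρ x z a b).tsum_add (hBM ρ x z a b), Finset.sum_add_distrib, Finset.sum_add_distrib]
  ring

variable (𝕄 : MKer (d + 1) (Fib d))

/-- [folklore] The column weights against a diagonal-contact family are summable once they are against its symbol. -/
theorem summable_colH_conjV_diag (A : MKer (d + 1) (Fib d)) {g : Fin (d + 1) → (Fin (d + 1) → ℤ) → (Fin (d + 1) → ℤ) → Fib d → ℝ}
    (μ : Fin (d + 1)) (y : Fin (d + 1) → ℤ)
    (hg : ∀ (κ : Fin (d + 1)) (p : Fin (d + 1) → ℤ) (c : Fib d), Summable fun u => colH A N μ y κ u * g κ u p c)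
    (κ : Fin (d + 1)) (x z : Fin (d + 1) → ℤ) (a b : Fib d) :
    Summable fun u => colH A N μ y κ u * conjV 𝕄 (diagK (g κ u)) x z a b := by
  simp only [conjV_diagK_apply]
  exact ((((hg κ z b).sub (hg κ x a)).mul_left (𝕄 x z a b))).congr fun u => by ring

/-- [folklore] **THE TABLE SLOT OF `dM` WITH A DIAGONAL-CONTACT ♯-TABLE, through ANY reading kernel `A`**:
`dM A N (S + conjV 𝕄 (X ·)) M b = dM A N S M b + conjV 𝕄 (diagK (G^A b))`, `G^A b p c = Σ_κ Σ'_u colH A N b κ u · g κ u p c`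
(`VertexReflectionContact.vertexOfK_conjV_diagK`). -/
theorem dM_table_sharp_split (A : MKer (d + 1) (Fib d)) (S M : Fin (d + 1) → (Fin (d + 1) → ℤ) → MKer (d + 1) (Fib d))
    {g : Fin (d + 1) → (Fin (d + 1) → ℤ) → (Fin (d + 1) → ℤ) → Fib d → ℝ} (μ : Fin (d + 1)) (y : Fin (d + 1) → ℤ)
    (hAS : ∀ (κ : Fin (d + 1)) (x z : Fin (d + 1) → ℤ) (a b : Fib d), Summable fun u => colH A N μ y κ u * S κ u x z a b)
    (hAg : ∀ (μ : Fin (d + 1)) (y : Fin (d + 1) → ℤ) (κ : Fin (d + 1)) (p : Fin (d + 1) → ℤ) (c : Fib d),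
      Summable fun u => colH A N μ y κ u * g κ u p c) :
    dM A N (fun κ u => S κ u + conjV 𝕄 (diagK (g κ u))) M μ y =
      dM A N S M μ y + conjV 𝕄 (diagK fun p c => ∑ κ, ∑' u, colH A N μ y κ u * g κ u p c) := by
  rw [dM_table_add N A μ y hAS (summable_colH_conjV_diag N 𝕄 A μ y (hAg μ y)), vertexOfK_conjV_diagK A 𝕄 N g hAg μ y]

end FirstOrder

/-! ## §4 The response: the ♯-derivative of the inverse and the displayed residual -/

section Response

variable {K : MKer (d + 1) (Fib d)} {N : ℕ} (𝕄 : MKer (d + 1) (Fib d))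

/-- [folklore] **THE DERIVATIVE OF THE INVERSE IS ADDITIVE IN THE FIELD TABLE** (spread `K`; localised `dM` and contact vertex):
`K2OfK K N (S + C) M c = K2OfK K N S M c + (−(K ∘ vertexOfK K N C c ∘ K))`. -/
theorem K2OfK_table_add (hKs : Spr K) {S C M : Fin (d + 1) → (Fin (d + 1) → ℤ) → MKer (d + 1) (Fib d)} (ν : Fin (d + 1))
    (y' : Fin (d + 1) → ℤ)
    (hS : ∀ (κ : Fin (d + 1)) (x z : Fin (d + 1) → ℤ) (a b : Fib d), Summable fun u => colH K N ν y' κ u * S κ u x z a b)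
    (hC : ∀ (κ : Fin (d + 1)) (x z : Fin (d + 1) → ℤ) (a b : Fib d), Summable fun u => colH K N ν y' κ u * C κ u x z a b)
    (hDl : Loc (dM K N S M ν y')) (hVl : Loc (vertexOfK K N C ν y')) :
    K2OfK K N (fun κ u => S κ u + C κ u) M ν y' = K2OfK K N S M ν y' + -(comp (comp K (vertexOfK K N C ν y')) K) := by
  have hKt : Tame K := hKs.tame
  rw [SecondOrderTransport.K2OfK_eq, SecondOrderTransport.K2OfK_eq, dM_table_add N K ν y' hS hC, comp_add_right_tame hKt hDl.tame hVl.tame,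
    comp_add_left_tame (hKs.comp_loc hDl).tame (hKs.comp_loc hVl).tame hKt, neg_add]

/-- [folklore] **THE ♯-DERIVATIVE OF THE INVERSE**: with the diagonal-contact ♯-table,
`K2OfK K N (S + conjV 𝕄 (X ·)) M c = K2OfK K N S M c + Ξ c`, **`Ξ c := −(K ∘ conjV 𝕄 (diagK (G c)) ∘ K)`** (`G c` dressed by `colH K`). -/
theorem K2OfK_sharp_split (hKs : Spr K) (h𝕄 : Spr 𝕄) {S M : Fin (d + 1) → (Fin (d + 1) → ℤ) → MKer (d + 1) (Fib d)}
    {g : Fin (d + 1) → (Fin (d + 1) → ℤ) → (Fin (d + 1) → ℤ) → Fib d → ℝ} (ν : Fin (d + 1)) (y' : Fin (d + 1) → ℤ)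
    (hS : ∀ (κ : Fin (d + 1)) (x z : Fin (d + 1) → ℤ) (a b : Fib d), Summable fun u => colH K N ν y' κ u * S κ u x z a b)
    (hg : ∀ (μ : Fin (d + 1)) (y : Fin (d + 1) → ℤ) (κ : Fin (d + 1)) (p : Fin (d + 1) → ℤ) (c : Fib d),
      Summable fun u => colH K N μ y κ u * g κ u p c)
    (hDl : Loc (dM K N S M ν y')) (hGl : Loc (diagK fun p c => ∑ κ, ∑' u, colH K N ν y' κ u * g κ u p c)) :
    K2OfK K N (fun κ u => S κ u + conjV 𝕄 (diagK (g κ u))) M ν y' =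
      K2OfK K N S M ν y' + -(comp (comp K (conjV 𝕄 (diagK fun p c => ∑ κ, ∑' u, colH K N ν y' κ u * g κ u p c))) K) := by
  have hV := vertexOfK_conjV_diagK K 𝕄 N g hg ν y'
  rw [K2OfK_table_add hKs ν y' hS (summable_colH_conjV_diag N 𝕄 K ν y' (hg ν y')) hDl (by rw [hV]; exact loc_conjV h𝕄 hGl), hV]

/-- [folklore] **THE ♯-RESPONSE SPLITS OFF ONE DISPLAYED RESIDUAL.**  Reading the ♯-table through the ♯-differentiated inverse
`A♯ := K2OfK K N S M c + Ξ c`:  `dM A♯ N S♯ M b = dM (K2OfK K N S M c) N S M b + dM (Ξ c) N S M b + conjV 𝕄 (diagK (G^{A♯} b))` — the middle term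
**`Δ b c := dM (Ξ c) N S M b`** (the columns of `Ξ c` read against the UNCONTACTED first-order tables) is the one piece NOT of an5's contact shape
a priori; the last term is a `conjV 𝕄`-contact, absorbed in the `X₂` slot of `conjW₂` (`[𝕄, X₂]`).  Entrywise summabilities are the only hypotheses. -/
theorem resp_sharp_split [NeZero N] (Ξ : MKer (d + 1) (Fib d)) {S M : Fin (d + 1) → (Fin (d + 1) → ℤ) → MKer (d + 1) (Fib d)}
    {g : Fin (d + 1) → (Fin (d + 1) → ℤ) → (Fin (d + 1) → ℤ) → Fib d → ℝ} (μ : Fin (d + 1)) (y : Fin (d + 1) → ℤ) (ν : Fin (d + 1))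
    (y' : Fin (d + 1) → ℤ)
    (hAS : ∀ (κ : Fin (d + 1)) (x z : Fin (d + 1) → ℤ) (a b : Fib d), Summable fun u => colH (K2OfK K N S M ν y') N μ y κ u * S κ u x z a b)
    (hΞS : ∀ (κ : Fin (d + 1)) (x z : Fin (d + 1) → ℤ) (a b : Fib d), Summable fun u => colH Ξ N μ y κ u * S κ u x z a b)
    (hAM : ∀ (ρ : Fin (d + 1)) (x z : Fin (d + 1) → ℤ) (a b : Fib d), Summable fun w => colM (K2OfK K N S M ν y') N μ y ρ w * M ρ w x z a b)
    (hΞM : ∀ (ρ : Fin (d + 1)) (x z : Fin (d + 1) → ℤ) (a b : Fib d), Summable fun w => colM Ξ N μ y ρ w * M ρ w x z a b)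
    (hg : ∀ (μ : Fin (d + 1)) (y : Fin (d + 1) → ℤ) (κ : Fin (d + 1)) (p : Fin (d + 1) → ℤ) (c : Fib d),
      Summable fun u => colH (K2OfK K N S M ν y' + Ξ) N μ y κ u * g κ u p c) :
    dM (K2OfK K N S M ν y' + Ξ) N (fun κ u => S κ u + conjV 𝕄 (diagK (g κ u))) M μ y =
      dM (K2OfK K N S M ν y') N S M μ y + dM Ξ N S M μ y +
        conjV 𝕄 (diagK fun p c => ∑ κ, ∑' u, colH (K2OfK K N S M ν y' + Ξ) N μ y κ u * g κ u p c) := by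
  have hsum : ∀ (κ : Fin (d + 1)) (x z : Fin (d + 1) → ℤ) (a b : Fib d),
      Summable fun u => colH (K2OfK K N S M ν y' + Ξ) N μ y κ u * S κ u x z a b := fun κ x z a b => by
    simpa only [colH_add, add_mul] using (hAS κ x z a b).add (hΞS κ x z a b)
  rw [dM_table_sharp_split N 𝕄 _ S M μ y hsum hg, dM_kernel_add N _ Ξ S M μ y hAS hΞS hAM hΞM]

end Response

end Summit.QuantumFields.BalabanUV.Beta.SecondOrderContactForm

end
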